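import Summits.ResolutionOfSingularities.ResolutionOfSingularities.Theorems.EquisingularLiftEquisingularLiftNatDirStepUnobsIsoTransport
import Summits.ResolutionOfSingularities.ResolutionOfSingularities.Theorems.EquisingularLiftEquisingularLiftNatFreshPlaneProj
import Literature.AlgebraicGeometry.Resolution.ProjectiveSpaceRegular
import HarnessLib

/-!
# [OURS · L1 W4.5(b) · EL♮(3) · NEST host kit, brick (L5)] The `∀ R e` model hypothesis of the fresh-plane door from ONE chart isomorphism

Cell `res-hironaka`, LADDER-RESOLUTION rung L (D-0089), slot W4.5(b), crux chain w45b: child crux **EL♮(3)** = stmt-ResolutionOfSingularities-20148.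
WIDTH seat res-L1-w45b-iso-w4 g2 (D-0157 DOOR 1), free hand (certificate currency of WIDTH TABLES D3/D4). `--supports stmt-ResolutionOfSingularities-20148
--as helper`. OURS; NOT a statement of H. Hironaka's 2017 manuscript (nothing of [Hironaka2017] is asserted); AI-written, and AI review is weaker than expert
review. DEF-FREE; no `sorry`; standard axioms. EL♮(3) is NOT proved here; resolution of singularities in positive characteristic is NOT proved here
(dimension 3 is Cossart–Piltant 2008/2009 in print); counted 0 toward the summit.

WHAT. `hmodel_of_one_model` — in the exact binder shape of res-L1-w45b-iso-w2's ✓ `dirStepUnobs_freshPlane_of_forall_model` (p656762,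
`…NatFreshPlaneProj`: `∀ (R : CommRingCat) (_ : IsField R), ∀ e : Proj (Segre.grading (Fin (n+1)) R) ≅ W, DirStepUnobs (Proj …) univ _ (e⁻¹ Z) _`):
this `∀`-statement follows from ONE isomorphism `e₀ : ℙⁿ_k ≅ W` (any field `k`, e.g. the customer's explicit chart isomorphism) together with a model
certificate `DirStepUnobs ℙⁿ_k univ _ (e₀⁻¹ Z) _` — by ✓ `dirStepUnobs_preimage_of_one_model` ((L4), transport along `e₀ ≫ e⁻¹`), `ℙⁿ_R` being reduced
for `R` a field (`isIntegral_projectiveSpace`). `hmodel_freshPlane_of_one_model` is the instance `W := redSub G' (υ⁻¹{x}) _` feeding the door verbatim,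
and `dirStepUnobs_freshPlane_of_one_model` composes the two: ONE explicit plane chart + ONE model certificate ⟹ the NEST clause `DirStepUnobs G' (υ⁻¹{x}) _ Z hZ`.

References (index only): R. Hartshorne, *Algebraic Geometry* (1977), III.5 [cite: Hartshorne1977].
-/

set_option linter.dupNamespace false

noncomputable section

-- `TopCat.Presheaf`/`Scheme.Modules` are not reducible (as in Mathlib's `AlgebraicGeometry/Modules`).
set_option backward.isDefEq.respectTransparency false

open CategoryTheory AlgebraicGeometry
open Literature.AlgebraicGeometry.Resolution (IsBlowup)
open AlgebraicGeometry.Scheme.IdealSheafData (vanishingIdeal)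

namespace Summit.ResolutionOfSingularities.ResolutionOfSingularities.Cruxes.EquisingularLiftNat.Sections

/-- **`ℙⁿ_R` is reduced for `R` a field given as a `CommRingCat` with `IsField`** (the binder shape of the fresh-plane door). [folklore] -/
theorem isReduced_proj_of_isField (n : ℕ) (R : CommRingCat.{0}) (hR : IsField R) :
    letI := MvPolynomial.gradedAlgebra (σ := Fin (n + 1)) (R := (R : Type))
    IsReduced (Proj (Literature.AlgebraicGeometry.Motives.Segre.grading (Fin (n + 1)) R)) := by
  letI := MvPolynomial.gradedAlgebra (σ := Fin (n + 1)) (R := (R : Type))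
  letI : Field R := hR.toField
  haveI : IsIntegral (Proj (Literature.AlgebraicGeometry.Motives.Segre.grading (Fin (n + 1)) R)) :=
    Literature.AlgebraicGeometry.Resolution.isIntegral_projectiveSpace n R
  infer_instance

/-- ★★ **THE `∀ R e` MODEL HYPOTHESIS FROM ONE CHART ISOMORPHISM.** `W` reduced, `Z ⊆ W`, `e₀ : ℙⁿ_k ≅ W` one isomorphism with a model certificate
`DirStepUnobs ℙⁿ_k univ _ (e₀⁻¹ Z) _`; then for every field `R` (as `CommRingCat` + `IsField`) and every `e : ℙⁿ_R ≅ W`: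
`DirStepUnobs ℙⁿ_R univ _ (e⁻¹ Z) _`. [OURS · L1 W4.5b · EL♮(3) · host kit (L5); NOT a statement of the manuscript] -/
theorem hmodel_of_one_model {n : ℕ} {W : Scheme.{0}} [IsReduced W] (Z : Set W) {k : Type} [Field k]
    (e₀ : (letI := MvPolynomial.gradedAlgebra (σ := Fin (n + 1)) (R := k);
      Proj (Literature.AlgebraicGeometry.Motives.Segre.grading (Fin (n + 1)) k)) ≅ W)
    (hZ₀ : IsClosed ((e₀.hom : _ → W) ⁻¹' Z))
    (h₀ : letI := MvPolynomial.gradedAlgebra (σ := Fin (n + 1)) (R := k);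
      DirStepUnobs (Proj (Literature.AlgebraicGeometry.Motives.Segre.grading (Fin (n + 1)) k)) Set.univ isClosed_univ
        ((e₀.hom : _ → W) ⁻¹' Z) hZ₀)
    (R : CommRingCat.{0}) (hR : IsField R) :
    letI := MvPolynomial.gradedAlgebra (σ := Fin (n + 1)) (R := (R : Type))
    ∀ (e : Proj (Literature.AlgebraicGeometry.Motives.Segre.grading (Fin (n + 1)) R) ≅ W)
      (hZ : IsClosed ((e.hom : _ → W) ⁻¹' Z)),
      DirStepUnobs (Proj (Literature.AlgebraicGeometry.Motives.Segre.grading (Fin (n + 1)) R)) Set.univ isClosed_univ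
        ((e.hom : _ → W) ⁻¹' Z) hZ := by
  intro e hZ
  letI := MvPolynomial.gradedAlgebra (σ := Fin (n + 1)) (R := k)
  haveI : IsReduced (Proj (Literature.AlgebraicGeometry.Motives.Segre.grading (Fin (n + 1)) k)) := by
    haveI : IsIntegral (Proj (Literature.AlgebraicGeometry.Motives.Segre.grading (Fin (n + 1)) k)) :=
      Literature.AlgebraicGeometry.Resolution.isIntegral_projectiveSpace n k
    infer_instance
  haveI := isReduced_proj_of_isField n R hR
  exact dirStepUnobs_preimage_of_one_model Z e₀ hZ₀ h₀ e hZ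

/-- ★★ **THE NEST CLAUSE FROM ONE EXPLICIT PLANE CHART AND ONE MODEL CERTIFICATE** — composition with res-L1-w45b-iso-w2's fresh-plane door
✓ `dirStepUnobs_freshPlane_of_forall_model`: in its setting (point step `υ` at a closed point `x` with `𝒪_{G,x}` regular of dimension `n + 1`,
`Z ⊆ υ⁻¹{x}` closed), ONE isomorphism `e₀ : ℙⁿ_k ≅ Ẽ_x = redSub G' (υ⁻¹{x}) _` over ANY field `k` and the model certificate for
`e₀⁻¹(redSubι⁻¹ Z)` give `DirStepUnobs G' (υ⁻¹{x}) _ Z hZ`. [OURS · L1 W4.5b · EL♮(3) · host kit (L5); NOT a statement of the manuscript] -/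
theorem dirStepUnobs_freshPlane_of_one_model {G G' : Scheme.{0}} [IsLocallyNoetherian G]
    {x : G} (hx : IsClosed ({x} : Set G)) (hreg : IsRegularLocalRing (G.presheaf.stalk x))
    {n : ℕ} (hdim : ringKrullDim (G.presheaf.stalk x) = (n + 1 : ℕ))
    {υ : G' ⟶ G} (hυ : IsBlowup υ (vanishingIdeal ⟨{x}, hx⟩))
    (Z : Set G') (hZ : IsClosed Z) (hZE : Z ⊆ υ ⁻¹' {x})
    {k : Type} [Field k]
    (e₀ : (letI := MvPolynomial.gradedAlgebra (σ := Fin (n + 1)) (R := k);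
      Proj (Literature.AlgebraicGeometry.Motives.Segre.grading (Fin (n + 1)) k)) ≅ redSub G' (υ ⁻¹' {x}) (hx.preimage υ.continuous))
    (h₀ : letI := MvPolynomial.gradedAlgebra (σ := Fin (n + 1)) (R := k);
      DirStepUnobs (Proj (Literature.AlgebraicGeometry.Motives.Segre.grading (Fin (n + 1)) k)) Set.univ isClosed_univ
        ((e₀.hom : _ → redSub G' (υ ⁻¹' {x}) (hx.preimage υ.continuous)) ⁻¹'
          ((redSubι G' (υ ⁻¹' {x}) (hx.preimage υ.continuous)) ⁻¹' Z))
        ((hZ.preimage (redSubι G' (υ ⁻¹' {x}) (hx.preimage υ.continuous)).continuous).preimage e₀.hom.continuous)) :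
    DirStepUnobs G' (υ ⁻¹' {x}) (hx.preimage υ.continuous) Z hZ := by
  haveI : IsReduced (redSub G' (υ ⁻¹' {x}) (hx.preimage υ.continuous)) := isReduced_redSub G' _ _
  refine dirStepUnobs_freshPlane_of_forall_model hx hreg hdim hυ Z hZ hZE fun R hR => ?_
  letI := MvPolynomial.gradedAlgebra (σ := Fin (n + 1)) (R := (R : Type))
  intro e
  exact hmodel_of_one_model _ e₀ _ h₀ R hR e _

end Summit.ResolutionOfSingularities.ResolutionOfSingularities.Cruxes.EquisingularLiftNat.Sections

end
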